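import Summits.Ventures.CertifiedManyBodySolver.Observables.MeanFieldClassExclusionObjectEYbco106
import Literature.MathematicalPhysics.QuantumLattice.HubbardFermiSeaTangentRowsDeepColumns
import Literature.MathematicalPhysics.QuantumLattice.HubbardFermiSeaTangentRowsBoxEnds
import Literature.MathematicalPhysics.QuantumLattice.HubbardFermiSeaTangentRowsLow
import Literature.MathematicalPhysics.QuantumLattice.HubbardFermiSeaTangentRowsLowB
import Literature.MathematicalPhysics.QuantumLattice.HubbardFermiSeaTangentRowsLscoColumns
import Summits.Ventures.CertifiedManyBodySolver.Certificates.HubbardSquare_afhfCap_n1_U5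
import Summits.Ventures.CertifiedManyBodySolver.Certificates.HubbardSquare_afhfCap_n1_U6
import Summits.Ventures.CertifiedManyBodySolver.Certificates.HubbardSquare_afhfCap_n1_U7
import HarnessLib

/-!
# Ventures/CertifiedManyBodySolver — Observables/MeanFieldClassExclusionPolarisedCapV2LaUnderdoped.lean

HONEST FRAMING: first certified bounds; not a superconductivity verdict; every number certified or labelled float.
A competing-order EXCLUSION removes a named class of candidate ground states; it never says which order is present;
no phase sentence follows.

Cell `hubbard-tc` (MO-S3, D-0096), seat `hubbard-tc-mod-3` (G3: competing orders as exclusion inputs from certified energy ORDERINGS),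
`prover-hubbard-tc-mod-3-g6-0`. **UNCONDITIONAL EDITIONS, round 2 (`_v2`: polarised-sea ∧ AF-Hartree–Fock caps)** of the registry's MF/BCS-class exclusion words on the UNDERDOPED La₂₋ₓSrₓCuO₄ columns x = 0, 0.03, 0.05, 0.07 (`[5.9, 14.7] × [−0.30, −0.20]`, `n ≥ 0.91`) and the iridate control M29 — capped by the VACUUM CHORD of the kernel AF-Hartree–Fock half-filling cap (`U_c = 5`), which beats both the polarised sea and the certified #21 anchor near half filling.
The earlier words (`MeanFieldClassExclusionObjectE{,2,Hg,Hg1223,Tl2201}.lean`, `…LaLowU(B).lean`, …) take mbsolver claim nodes (#445, #473, #472, #498,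
#21) as hypotheses because their CAPS are transported certified anchors. Round 1 (`…PolarisedCap*.lean`) capped with the fully POLARISED one-species grid-cell Fermi sea — a
`U`-independent Slater determinant whose energy plane `e₀(1, s, U, n_j) ≤ A_j + s·B_j` is certified IN THE KERNEL by the tree's
`TTPrimeFree.polarizedPlaneCheck` (file `HubbardTTPrimePolarizedSeaCapTable`, the device behind hubbard-box-p2's sandwich words; `M = 40`, interval
enclosures of the cell-averaged cosines, `decide +kernel`). On hole-doped faces with `t' ≲ −0.2` this cap lies `0.2–0.4·t` BELOW the transported
anchors, so the docc tail closes at the Stoner-type threshold `U₁ = (e_pol − e_free)/(n/2)²` — LOWER than before — and WITHOUT any claim node: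
a non-magnetic Hartree–Fock / singlet-BCS state has energy `≥ e_free + U(n/2)²` (Wick; Bach–Lieb–Solovej 1994 §2), the ground state has energy
`≤ e_pol` at every `U`, and concavity in `U` gives `docc_GS ≤ (e_pol − e_free)/U`.

Every word: for the stated `t'`-range (⊇ the S1 box of record), EVERY `U ≥ U₁` and the stated filling band (⊇ the box band, ends on the
`1/1600` grid of the certificate), every torus limit `ω` of unit `(rectN n L, S^z = 0)`-sector ground states of `hubbardTorusTT' L 1 t' U` has
`Re ω(n_{0↑} n_{0↓}) < (n/2)²` (the identification «no HF/BCS ground state» is the docstring's reading; the THEOREM is the strict docc inequality):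

* `laP_x0_docc_lt_v2` — La₂CuO₄ parent (VSET M13), La object E `[5.9, 14.7] × [−0.30, −0.20]`, hole half `n ∈ [0.99, 1]`: `t' ∈ [-3/10, -1/5]` × `n ∈ [99/100, 1]`, EVERY `U ≥ 41/10` (box `[5.9, 14.7]`; before: `laP_x0_docc_lt (round 1) ⊂ laLow_x0_docc_lt_of (U ≥ 5.9 = whole box; #445 ∧ #21) — this edition is WEAKER in coverage, its merit is «no claim node»`);
* `laP_x003_docc_lt_v2` — La₁.₉₇Sr₀.₀₃CuO₄ x = 0.03, `n ∈ [0.95, 0.99]`: `t' ∈ [-3/10, -1/5]` × `n ∈ [19/20, 99/100]`, EVERY `U ≥ 9/2` (box `[5.9, 14.7]`; before: `laP_x003_docc_lt (round 1) ⊂ laLow_x003_docc_lt_of (U ≥ 5.9 = whole box; #445 ∧ #21) — weaker coverage, no claim node`);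
* `laP_x005_docc_lt_v2` — La₁.₉₅Sr₀.₀₅CuO₄ x = 0.05, `n ∈ [0.93, 0.97]`: `t' ∈ [-3/10, -1/5]` × `n ∈ [93/100, 97/100]`, EVERY `U ≥ 23/5` (box `[5.9, 14.7]`; before: `laP_x005_docc_lt (round 1) ⊂ laLow_x005_docc_lt_of (U ≥ 5.9 = whole box; #445 ∧ #21) — weaker coverage, no claim node`);
* `laP_x007_docc_lt_v2` — La₁.₉₃Sr₀.₀₇CuO₄ x = 0.07 (VSET M14), `n ∈ [0.91, 0.95]`: `t' ∈ [-3/10, -1/5]` × `n ∈ [91/100, 19/20]`, EVERY `U ≥ 24/5` (box `[5.9, 14.7]`; before: `laP_x007_docc_lt (round 1) ⊂ laLow_x007_docc_lt_of (U ≥ 5.9 = whole box; #445 ∧ #21) — weaker coverage, no claim node`);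
* `slioP_x010_docc_lt_v2` — Sr₁.₉La₀.₁IrO₄ (VSET #29 = M29, NEGATIVE CONTROL), PH-image face of box #58 `[7.6, 14.6] × [−0.35, −0.17] × [0.89, 0.91]`: `t' ∈ [-7/20, -17/100]` × `n ∈ [89/100, 91/100]`, EVERY `U ≥ 5` (box `[7.6, 14.6]`; before: `slioP_x010_docc_lt (round 1) ⊂ slioE_x010_docc_lt_of (U ≥ 5.9 ⊇ whole box; #445 ∧ #21)`);

Round 2 adds hubbard-box-p2's KERNEL-CHECKED antiferromagnetic Hartree–Fock cap planes at HALF FILLING (`afhfCap_n1_U5/U6/U7_at`: `e₀(1, t', U, 1) ≤ C_{U_c}` for every `t'` and every `U ≤ U_c`, `QFK.Cert` certificates, no hypothesis): the density chord from the polarised plane at the band's LOWER end to the AF-HF cap at `n = 1` (or, next to half filling, the vacuum chord `n·C_{U_c}`) is a far lower cap at the band's TOP than the polarised plane there, and the tail runs with `U_c ∈ {5, 6, 7}` (cap monotone in `U` below `U_c`, Hartree–Fock Lipschitz slope `(n/2)²` above — `doccN_lt_of_capUc_threshold`; thresholds `≤ U_c` by construction). Proof otherwise as round 1: CAP chord (`objE_capChord_mul`,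 convexity in `n`); FLOOR = kernel Fermi-sea tangent rows (cell-exact,
`HubbardFermiSeaTangentRows*`) at columns bracketing the box, read between columns by the `t'`-chord (`objE_floorChord_mul`, concavity in `t'`);
TAIL = `doccN_lt_of_capUc_threshold` with `U_c := U`; `(n/2)²` above its tangent at the band's lower end. Cap chord, floor chord and tangent are
bilinear in `(n, t')`: one `nlinarith` leaf per column piece with the four McCormick products of its rectangle (corner-exact). Exact margins
(designer `hubbard-tc-mod-3/g6-replay/editions/`, exact rationals on the tree constants) are printed in each docstring; binding corners sit at the
TOP filling and the SHALLOW `t'` end (the polarisation cost grows with `n` and toward `t' = 0`). The conditional words remain true and cited; these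
editions supersede them for box coverage. NEW COVERAGE: La x = 0 / 0.03 / 0.05 / 0.07 WHOLE box `[5.9, 14.7]` HYPOTHESIS-FREE (thresholds 4.1 / 4.5 / 4.6 / 4.8; round 1: 6.7 / 6.7 / 6.5 / 6.3; the conditional `laLow_*` words needed #445 ∧ #21); M29 from 5.0 (whole box `[7.6, 14.6]`).
WHAT THIS IS NOT: a statement about stripes/CDW, d-wave order or T_c; a claim that the ground state is polarised anywhere; tight; a phase word.

References: Bach–Lieb–Solovej, J. Stat. Phys. 76 (1994) 3, eq. (2c.36) [BachLiebSolovej1994]; Koma–Tasaki, J. Stat. Phys. 76 (1994) 745, §1 [KomaTasaki1994];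
Lieb–Loss, Duke Math. J. 71 (1993) 337, §8 Thm 8.2 [LiebLoss1993]; Israel (1979) Thm I.3.4 [Israel1979]; Ruelle (1969) §3.3 [Ruelle1969]; Neumaier, Acta Numerica 13 (2004) §11 [Neumaier2004CompleteSearch].
-/

noncomputable section

namespace Summit.Ventures.CertifiedManyBodySolver.Observables

open Literature.MathematicalPhysics.QuantumLattice
open Literature.MathematicalPhysics.QuantumLattice.ThermodynamicLimit
open Literature.MathematicalPhysics.QuantumLattice.TTPrimeFree
open Summit.Ventures.CertifiedManyBodySolver.Certificates
open Matrix HubbardWave0 Literature.Probability.LatticeModels Filter Topology Set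
open scoped ComplexOrder BigOperators

/-! ### §0 Device: the vacuum chord of a half-filling cap -/

/-- **Vacuum chord of a half-filling cap**: `e(1, s, U_c, 1) ≤ C`, `0 < n ≤ 1`, `U_c ≥ 0` give `e(1, s, U_c, n) ≤ n·C` (convexity of the density
function with `e(0) = 0`; the general-`U_c` form of `objE_half_cap8` / `edop_half_cap` with the end point `n = 1` included). [cite: Ruelle1969, §3.3] -/
theorem objE_vacChord_cap {s Uc n C : ℝ} (hUc : 0 ≤ Uc) (hC : energyDensityTT' 1 s Uc 1 ≤ C) (hn : 0 < n) (hn1 : n ≤ 1) :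
    energyDensityTT' 1 s Uc n ≤ n * C := by
  rcases eq_or_lt_of_le hn1 with h | h
  · rw [h, one_mul]
    exact hC
  · have hv := energyDensityTT'_le_vacuum_chord 1 s hUc hn h (by norm_num) hC
    rw [div_one] at hv
    exact hv

/-! ### §1 (no new certificates: the polarised-sea planes of round 1 are imported; the AF-Hartree–Fock half-filling caps are hubbard-box-p2's `afhfCap_n1_U5/U6/U7_at`) -/
/-! ### §2 The words (cap chord in `n`, floor chords in `t'`, one McCormick leaf per column piece; tail with `U_c := U`) -/
/-- **La₂CuO₄ parent (VSET M13), La object E `[5.9, 14.7] × [−0.30, −0.20]`, hole half `n ∈ [0.99, 1]`, `t' ∈ [-3/10, -1/5]` × `n ∈ [99/100, 1]` — MF/BCS class excluded at EVERY `U ≥ 41/10`, HYPOTHESIS-FREE** (box `U/t_eff ∈ [5.9, 14.7]`; supersedes for coverage the conditional `laP_x0_docc_lt (round 1) ⊂ laLow_x0_docc_lt_of (U ≥ 5.9 = whole box; #445 ∧ #21) — this edition is WEAKER in coverage, its merit is «no claim node»`). Every GS torus limit has `Re ω(n_{0↑}n_{0↓}) < (n/2)²`. Cap at `U_c = 5`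 = vacuum chord `n·C` of the kernel AF-HF half-filling cap `afhfCap_n1_U5_at`; floor = `t'`-chords of the kernel Fermi-sea columns `-3/10 | -1/4 | -1/5` (touch `1 | 1 | 1`); exact piece margins `+0.0189`, `+0.0292`. [cite: BachLiebSolovej1994, eq. (2c.36)] [cite: KomaTasaki1994, §1] [cite: LiebLoss1993, §8, Theorem 8.2] -/
theorem laP_x0_docc_lt_v2 {t' U n : ℝ} (ht1 : -3 / 10 ≤ t') (ht2 : t' ≤ -1 / 5) (hU : 41 / 10 ≤ U)
    (hn1 : 99 / 100 ≤ n) (hn2 : n ≤ 1) :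
    ∀ (ω : InfVolFermionState 2) (Ls : ℕ → ℕ) (ψ : ∀ L, Fock (Orb (FermionTorus 2 L))),
      Tendsto Ls atTop atTop →
      (∀ j, IsGroundStateInSector (hubbardTorusTT' (Ls j) 1 t' U) (rectN n (Ls j)) 0 (ψ (Ls j))) →
      (∀ j, star (ψ (Ls j)) ⬝ᵥ ψ (Ls j) = 1) → ω.IsTorusLimitOf ψ Ls →
      (ω.expect ({0} : Finset (Site 2))
        (nAt 0 (Finset.mem_singleton_self 0) 0 * nAt 0 (Finset.mem_singleton_self 0) 1)).re < (n / 2) ^ 2 := by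
  have hn0 : (0 : ℝ) ≤ n := by linarith
  have hn2' : n < 2 := by linarith
  have hsq : (-9801 / 40000 : ℝ) + 99 / 200 * n ≤ (n / 2) ^ 2 := by nlinarith [sq_nonneg (n - 99 / 100)]
  have hsqU : ((-9801 / 40000 : ℝ) + 99 / 200 * n) * (41 / 10) ≤ (n / 2) ^ 2 * (41 / 10) :=
    mul_le_mul_of_nonneg_right hsq (by norm_num)
  have hnpos : (0 : ℝ) < n := by linarith
  -- CAP at `U_c = 5`: vacuum chord of the kernel AF-Hartree–Fock half-filling cap (convexity in `n`, `e(0) = 0`)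
  have hcap := objE_vacChord_cap (by norm_num : (0 : ℝ) ≤ 5) (afhfCap_n1_U5_at t' (by norm_num : (0 : ℝ) ≤ 5) le_rfl) hnpos (by linarith)
  rcases le_or_gt t' (-1 / 4) with hp0 | hp0
  · -- piece `[-3/10, -1/4]`, columns `-3/10`, `-1/4`
    have ra := fermiSeaTangentRow_tPrime_neg_three_div_ten_at_one (U := 0) le_rfl hn0 hn2'
    have rb := fermiSeaTangentRow_tPrime_neg_one_div_four_at_one (U := 0) le_rfl hn0 hn2'
    have hfl := objE_floorChord_mul (s := t') (k := 20) hn0 hn2' (by norm_num : (-3 / 10 : ℝ) < -1 / 4) ra rb ht1 hp0 (by norm_num)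
    exact doccN_lt_of_capUc_threshold (U₁ := 41 / 10) (Uc := 5) (by norm_num) (by norm_num) hU hn0 hn2' hcap hfl
      (by nlinarith only [mul_nonneg (sub_nonneg.2 hn1) (sub_nonneg.2 ht1), mul_nonneg (sub_nonneg.2 hn1) (sub_nonneg.2 hp0), mul_nonneg (sub_nonneg.2 hn2) (sub_nonneg.2 ht1), mul_nonneg (sub_nonneg.2 hn2) (sub_nonneg.2 hp0), hsqU])
  · -- `t' > -1/4`
    have ra := fermiSeaTangentRow_tPrime_neg_one_div_four_at_one (U := 0) le_rfl hn0 hn2'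
    have rb := fermiSeaTangentRow_tPrime_neg_one_div_five_at_one (U := 0) le_rfl hn0 hn2'
    have hfl := objE_floorChord_mul (s := t') (k := 20) hn0 hn2' (by norm_num : (-1 / 4 : ℝ) < -1 / 5) ra rb hp0.le ht2 (by norm_num)
    exact doccN_lt_of_capUc_threshold (U₁ := 41 / 10) (Uc := 5) (by norm_num) (by norm_num) hU hn0 hn2' hcap hfl
      (by nlinarith only [mul_nonneg (sub_nonneg.2 hn1) (sub_nonneg.2 hp0.le), mul_nonneg (sub_nonneg.2 hn1) (sub_nonneg.2 ht2), mul_nonneg (sub_nonneg.2 hn2) (sub_nonneg.2 hp0.le), mul_nonneg (sub_nonneg.2 hn2) (sub_nonneg.2 ht2), hsqU])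

/-- **La₁.₉₇Sr₀.₀₃CuO₄ x = 0.03, `n ∈ [0.95, 0.99]`, `t' ∈ [-3/10, -1/5]` × `n ∈ [19/20, 99/100]` — MF/BCS class excluded at EVERY `U ≥ 9/2`, HYPOTHESIS-FREE** (box `U/t_eff ∈ [5.9, 14.7]`; supersedes for coverage the conditional `laP_x003_docc_lt (round 1) ⊂ laLow_x003_docc_lt_of (U ≥ 5.9 = whole box; #445 ∧ #21) — weaker coverage, no claim node`). Every GS torus limit has `Re ω(n_{0↑}n_{0↓}) < (n/2)²`. Cap at `U_c = 5` = vacuum chord `n·C` of the kernel AF-HF half-filling cap `afhfCap_n1_U5_at`; floor = `t'`-chords of the kernel Fermi-sea columns `-3/10 | -1/4 | -1/5` (touch `1 | 1 | 1`); exact piece margins `+0.0288`, `+0.0354`. [cite: BachLiebSolovej1994, eq. (2c.36)] [cite: KomaTasaki1994, §1] [cite: LiebLoss1993, §8, Theorem 8.2] -/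
theorem laP_x003_docc_lt_v2 {t' U n : ℝ} (ht1 : -3 / 10 ≤ t') (ht2 : t' ≤ -1 / 5) (hU : 9 / 2 ≤ U)
    (hn1 : 19 / 20 ≤ n) (hn2 : n ≤ 99 / 100) :
    ∀ (ω : InfVolFermionState 2) (Ls : ℕ → ℕ) (ψ : ∀ L, Fock (Orb (FermionTorus 2 L))),
      Tendsto Ls atTop atTop →
      (∀ j, IsGroundStateInSector (hubbardTorusTT' (Ls j) 1 t' U) (rectN n (Ls j)) 0 (ψ (Ls j))) →
      (∀ j, star (ψ (Ls j)) ⬝ᵥ ψ (Ls j) = 1) → ω.IsTorusLimitOf ψ Ls →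
      (ω.expect ({0} : Finset (Site 2))
        (nAt 0 (Finset.mem_singleton_self 0) 0 * nAt 0 (Finset.mem_singleton_self 0) 1)).re < (n / 2) ^ 2 := by
  have hn0 : (0 : ℝ) ≤ n := by linarith
  have hn2' : n < 2 := by linarith
  have hsq : (-361 / 1600 : ℝ) + 19 / 40 * n ≤ (n / 2) ^ 2 := by nlinarith [sq_nonneg (n - 19 / 20)]
  have hsqU : ((-361 / 1600 : ℝ) + 19 / 40 * n) * (9 / 2) ≤ (n / 2) ^ 2 * (9 / 2) :=
    mul_le_mul_of_nonneg_right hsq (by norm_num)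
  have hnpos : (0 : ℝ) < n := by linarith
  -- CAP at `U_c = 5`: vacuum chord of the kernel AF-Hartree–Fock half-filling cap (convexity in `n`, `e(0) = 0`)
  have hcap := objE_vacChord_cap (by norm_num : (0 : ℝ) ≤ 5) (afhfCap_n1_U5_at t' (by norm_num : (0 : ℝ) ≤ 5) le_rfl) hnpos (by linarith)
  rcases le_or_gt t' (-1 / 4) with hp0 | hp0
  · -- piece `[-3/10, -1/4]`, columns `-3/10`, `-1/4`
    have ra := fermiSeaTangentRow_tPrime_neg_three_div_ten_at_one (U := 0) le_rfl hn0 hn2'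
    have rb := fermiSeaTangentRow_tPrime_neg_one_div_four_at_one (U := 0) le_rfl hn0 hn2'
    have hfl := objE_floorChord_mul (s := t') (k := 20) hn0 hn2' (by norm_num : (-3 / 10 : ℝ) < -1 / 4) ra rb ht1 hp0 (by norm_num)
    exact doccN_lt_of_capUc_threshold (U₁ := 9 / 2) (Uc := 5) (by norm_num) (by norm_num) hU hn0 hn2' hcap hfl
      (by nlinarith only [mul_nonneg (sub_nonneg.2 hn1) (sub_nonneg.2 ht1), mul_nonneg (sub_nonneg.2 hn1) (sub_nonneg.2 hp0), mul_nonneg (sub_nonneg.2 hn2) (sub_nonneg.2 ht1), mul_nonneg (sub_nonneg.2 hn2) (sub_nonneg.2 hp0), hsqU])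
  · -- `t' > -1/4`
    have ra := fermiSeaTangentRow_tPrime_neg_one_div_four_at_one (U := 0) le_rfl hn0 hn2'
    have rb := fermiSeaTangentRow_tPrime_neg_one_div_five_at_one (U := 0) le_rfl hn0 hn2'
    have hfl := objE_floorChord_mul (s := t') (k := 20) hn0 hn2' (by norm_num : (-1 / 4 : ℝ) < -1 / 5) ra rb hp0.le ht2 (by norm_num)
    exact doccN_lt_of_capUc_threshold (U₁ := 9 / 2) (Uc := 5) (by norm_num) (by norm_num) hU hn0 hn2' hcap hfl
      (by nlinarith only [mul_nonneg (sub_nonneg.2 hn1) (sub_nonneg.2 hp0.le), mul_nonneg (sub_nonneg.2 hn1) (sub_nonneg.2 ht2), mul_nonneg (sub_nonneg.2 hn2) (sub_nonneg.2 hp0.le), mul_nonneg (sub_nonneg.2 hn2) (sub_nonneg.2 ht2), hsqU])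

/-- **La₁.₉₅Sr₀.₀₅CuO₄ x = 0.05, `n ∈ [0.93, 0.97]`, `t' ∈ [-3/10, -1/5]` × `n ∈ [93/100, 97/100]` — MF/BCS class excluded at EVERY `U ≥ 23/5`, HYPOTHESIS-FREE** (box `U/t_eff ∈ [5.9, 14.7]`; supersedes for coverage the conditional `laP_x005_docc_lt (round 1) ⊂ laLow_x005_docc_lt_of (U ≥ 5.9 = whole box; #445 ∧ #21) — weaker coverage, no claim node`). Every GS torus limit has `Re ω(n_{0↑}n_{0↓}) < (n/2)²`. Cap at `U_c = 5` = vacuum chord `n·C` of the kernel AF-HF half-filling cap `afhfCap_n1_U5_at`; floor = `t'`-chords of the kernel Fermi-sea columns `-3/10 | -1/4 | -1/5` (touch `93/100 | 93/100 | 93/100`); exact piece margins `+0.0145`, `+0.0190`. [cite: BachLiebSolovej1994, eq. (2c.36)] [cite: KomaTasaki1994, §1] [cite: LiebLoss1993, §8, Theorem 8.2] -/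
theorem laP_x005_docc_lt_v2 {t' U n : ℝ} (ht1 : -3 / 10 ≤ t') (ht2 : t' ≤ -1 / 5) (hU : 23 / 5 ≤ U)
    (hn1 : 93 / 100 ≤ n) (hn2 : n ≤ 97 / 100) :
    ∀ (ω : InfVolFermionState 2) (Ls : ℕ → ℕ) (ψ : ∀ L, Fock (Orb (FermionTorus 2 L))),
      Tendsto Ls atTop atTop →
      (∀ j, IsGroundStateInSector (hubbardTorusTT' (Ls j) 1 t' U) (rectN n (Ls j)) 0 (ψ (Ls j))) →
      (∀ j, star (ψ (Ls j)) ⬝ᵥ ψ (Ls j) = 1) → ω.IsTorusLimitOf ψ Ls →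
      (ω.expect ({0} : Finset (Site 2))
        (nAt 0 (Finset.mem_singleton_self 0) 0 * nAt 0 (Finset.mem_singleton_self 0) 1)).re < (n / 2) ^ 2 := by
  have hn0 : (0 : ℝ) ≤ n := by linarith
  have hn2' : n < 2 := by linarith
  have hsq : (-8649 / 40000 : ℝ) + 93 / 200 * n ≤ (n / 2) ^ 2 := by nlinarith [sq_nonneg (n - 93 / 100)]
  have hsqU : ((-8649 / 40000 : ℝ) + 93 / 200 * n) * (23 / 5) ≤ (n / 2) ^ 2 * (23 / 5) :=
    mul_le_mul_of_nonneg_right hsq (by norm_num)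
  have hnpos : (0 : ℝ) < n := by linarith
  -- CAP at `U_c = 5`: vacuum chord of the kernel AF-Hartree–Fock half-filling cap (convexity in `n`, `e(0) = 0`)
  have hcap := objE_vacChord_cap (by norm_num : (0 : ℝ) ≤ 5) (afhfCap_n1_U5_at t' (by norm_num : (0 : ℝ) ≤ 5) le_rfl) hnpos (by linarith)
  rcases le_or_gt t' (-1 / 4) with hp0 | hp0
  · -- piece `[-3/10, -1/4]`, columns `-3/10`, `-1/4`
    have ra := fermiSeaTangentRow_tPrime_neg_three_div_ten_at_ninetythree_div_hundred (U := 0) le_rfl hn0 hn2'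
    have rb := fermiSeaTangentRow_tPrime_neg_one_div_four_at_ninetythree_div_hundred (U := 0) le_rfl hn0 hn2'
    have hfl := objE_floorChord_mul (s := t') (k := 20) hn0 hn2' (by norm_num : (-3 / 10 : ℝ) < -1 / 4) ra rb ht1 hp0 (by norm_num)
    exact doccN_lt_of_capUc_threshold (U₁ := 23 / 5) (Uc := 5) (by norm_num) (by norm_num) hU hn0 hn2' hcap hfl
      (by nlinarith only [mul_nonneg (sub_nonneg.2 hn1) (sub_nonneg.2 ht1), mul_nonneg (sub_nonneg.2 hn1) (sub_nonneg.2 hp0), mul_nonneg (sub_nonneg.2 hn2) (sub_nonneg.2 ht1), mul_nonneg (sub_nonneg.2 hn2) (sub_nonneg.2 hp0), hsqU])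
  · -- `t' > -1/4`
    have ra := fermiSeaTangentRow_tPrime_neg_one_div_four_at_ninetythree_div_hundred (U := 0) le_rfl hn0 hn2'
    have rb := fermiSeaTangentRow_tPrime_neg_one_div_five_at_ninetythree_div_hundred (U := 0) le_rfl hn0 hn2'
    have hfl := objE_floorChord_mul (s := t') (k := 20) hn0 hn2' (by norm_num : (-1 / 4 : ℝ) < -1 / 5) ra rb hp0.le ht2 (by norm_num)
    exact doccN_lt_of_capUc_threshold (U₁ := 23 / 5) (Uc := 5) (by norm_num) (by norm_num) hU hn0 hn2' hcap hfl
      (by nlinarith only [mul_nonneg (sub_nonneg.2 hn1) (sub_nonneg.2 hp0.le), mul_nonneg (sub_nonneg.2 hn1) (sub_nonneg.2 ht2), mul_nonneg (sub_nonneg.2 hn2) (sub_nonneg.2 hp0.le), mul_nonneg (sub_nonneg.2 hn2) (sub_nonneg.2 ht2), hsqU])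

/-- **La₁.₉₃Sr₀.₀₇CuO₄ x = 0.07 (VSET M14), `n ∈ [0.91, 0.95]`, `t' ∈ [-3/10, -1/5]` × `n ∈ [91/100, 19/20]` — MF/BCS class excluded at EVERY `U ≥ 24/5`, HYPOTHESIS-FREE** (box `U/t_eff ∈ [5.9, 14.7]`; supersedes for coverage the conditional `laP_x007_docc_lt (round 1) ⊂ laLow_x007_docc_lt_of (U ≥ 5.9 = whole box; #445 ∧ #21) — weaker coverage, no claim node`). Every GS torus limit has `Re ω(n_{0↑}n_{0↓}) < (n/2)²`. Cap at `U_c = 5` = vacuum chord `n·C` of the kernel AF-HF half-filling cap `afhfCap_n1_U5_at`; floor = `t'`-chords of the kernel Fermi-sea columns `-3/10 | -1/4 | -1/5` (touch `93/100 | 93/100 | 93/100`); exact piece margins `+0.0164`, `+0.0194`. [cite: BachLiebSolovej1994, eq. (2c.36)] [cite: KomaTasaki1994, §1] [cite: LiebLoss1993, §8, Theorem 8.2] -/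
theorem laP_x007_docc_lt_v2 {t' U n : ℝ} (ht1 : -3 / 10 ≤ t') (ht2 : t' ≤ -1 / 5) (hU : 24 / 5 ≤ U)
    (hn1 : 91 / 100 ≤ n) (hn2 : n ≤ 19 / 20) :
    ∀ (ω : InfVolFermionState 2) (Ls : ℕ → ℕ) (ψ : ∀ L, Fock (Orb (FermionTorus 2 L))),
      Tendsto Ls atTop atTop →
      (∀ j, IsGroundStateInSector (hubbardTorusTT' (Ls j) 1 t' U) (rectN n (Ls j)) 0 (ψ (Ls j))) →
      (∀ j, star (ψ (Ls j)) ⬝ᵥ ψ (Ls j) = 1) → ω.IsTorusLimitOf ψ Ls →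
      (ω.expect ({0} : Finset (Site 2))
        (nAt 0 (Finset.mem_singleton_self 0) 0 * nAt 0 (Finset.mem_singleton_self 0) 1)).re < (n / 2) ^ 2 := by
  have hn0 : (0 : ℝ) ≤ n := by linarith
  have hn2' : n < 2 := by linarith
  have hsq : (-8281 / 40000 : ℝ) + 91 / 200 * n ≤ (n / 2) ^ 2 := by nlinarith [sq_nonneg (n - 91 / 100)]
  have hsqU : ((-8281 / 40000 : ℝ) + 91 / 200 * n) * (24 / 5) ≤ (n / 2) ^ 2 * (24 / 5) :=
    mul_le_mul_of_nonneg_right hsq (by norm_num)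
  have hnpos : (0 : ℝ) < n := by linarith
  -- CAP at `U_c = 5`: vacuum chord of the kernel AF-Hartree–Fock half-filling cap (convexity in `n`, `e(0) = 0`)
  have hcap := objE_vacChord_cap (by norm_num : (0 : ℝ) ≤ 5) (afhfCap_n1_U5_at t' (by norm_num : (0 : ℝ) ≤ 5) le_rfl) hnpos (by linarith)
  rcases le_or_gt t' (-1 / 4) with hp0 | hp0
  · -- piece `[-3/10, -1/4]`, columns `-3/10`, `-1/4`
    have ra := fermiSeaTangentRow_tPrime_neg_three_div_ten_at_ninetythree_div_hundred (U := 0) le_rfl hn0 hn2'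
    have rb := fermiSeaTangentRow_tPrime_neg_one_div_four_at_ninetythree_div_hundred (U := 0) le_rfl hn0 hn2'
    have hfl := objE_floorChord_mul (s := t') (k := 20) hn0 hn2' (by norm_num : (-3 / 10 : ℝ) < -1 / 4) ra rb ht1 hp0 (by norm_num)
    exact doccN_lt_of_capUc_threshold (U₁ := 24 / 5) (Uc := 5) (by norm_num) (by norm_num) hU hn0 hn2' hcap hfl
      (by nlinarith only [mul_nonneg (sub_nonneg.2 hn1) (sub_nonneg.2 ht1), mul_nonneg (sub_nonneg.2 hn1) (sub_nonneg.2 hp0), mul_nonneg (sub_nonneg.2 hn2) (sub_nonneg.2 ht1), mul_nonneg (sub_nonneg.2 hn2) (sub_nonneg.2 hp0), hsqU])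
  · -- `t' > -1/4`
    have ra := fermiSeaTangentRow_tPrime_neg_one_div_four_at_ninetythree_div_hundred (U := 0) le_rfl hn0 hn2'
    have rb := fermiSeaTangentRow_tPrime_neg_one_div_five_at_ninetythree_div_hundred (U := 0) le_rfl hn0 hn2'
    have hfl := objE_floorChord_mul (s := t') (k := 20) hn0 hn2' (by norm_num : (-1 / 4 : ℝ) < -1 / 5) ra rb hp0.le ht2 (by norm_num)
    exact doccN_lt_of_capUc_threshold (U₁ := 24 / 5) (Uc := 5) (by norm_num) (by norm_num) hU hn0 hn2' hcap hfl
      (by nlinarith only [mul_nonneg (sub_nonneg.2 hn1) (sub_nonneg.2 hp0.le), mul_nonneg (sub_nonneg.2 hn1) (sub_nonneg.2 ht2), mul_nonneg (sub_nonneg.2 hn2) (sub_nonneg.2 hp0.le), mul_nonneg (sub_nonneg.2 hn2) (sub_nonneg.2 ht2), hsqU])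

/-- **Sr₁.₉La₀.₁IrO₄ (VSET #29 = M29, NEGATIVE CONTROL), PH-image face of box #58 `[7.6, 14.6] × [−0.35, −0.17] × [0.89, 0.91]`, `t' ∈ [-7/20, -17/100]` × `n ∈ [89/100, 91/100]` — MF/BCS class excluded at EVERY `U ≥ 5`, HYPOTHESIS-FREE** (box `U/t_eff ∈ [7.6, 14.6]`; supersedes for coverage the conditional `slioP_x010_docc_lt (round 1) ⊂ slioE_x010_docc_lt_of (U ≥ 5.9 ⊇ whole box; #445 ∧ #21)`). Every GS torus limit has `Re ω(n_{0↑}n_{0↓}) < (n/2)²`. Cap at `U_c = 5` = vacuum chord `n·C` of the kernel AF-HF half-filling cap `afhfCap_n1_U5_at`; floor = `t'`-chords of the kernel Fermi-sea columns `-7/20 | -1/4 | -17/100` (touch `9/10 | 93/100 | 9/10`); exact piece margins `+0.0150`, `+0.0144`. [cite: BachLiebSolovej1994, eq. (2c.36)] [cite: KomaTasaki1994, §1] [cite: LiebLoss1993, §8, Theorem 8.2] -/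
theorem slioP_x010_docc_lt_v2 {t' U n : ℝ} (ht1 : -7 / 20 ≤ t') (ht2 : t' ≤ -17 / 100) (hU : 5 ≤ U)
    (hn1 : 89 / 100 ≤ n) (hn2 : n ≤ 91 / 100) :
    ∀ (ω : InfVolFermionState 2) (Ls : ℕ → ℕ) (ψ : ∀ L, Fock (Orb (FermionTorus 2 L))),
      Tendsto Ls atTop atTop →
      (∀ j, IsGroundStateInSector (hubbardTorusTT' (Ls j) 1 t' U) (rectN n (Ls j)) 0 (ψ (Ls j))) →
      (∀ j, star (ψ (Ls j)) ⬝ᵥ ψ (Ls j) = 1) → ω.IsTorusLimitOf ψ Ls →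
      (ω.expect ({0} : Finset (Site 2))
        (nAt 0 (Finset.mem_singleton_self 0) 0 * nAt 0 (Finset.mem_singleton_self 0) 1)).re < (n / 2) ^ 2 := by
  have hn0 : (0 : ℝ) ≤ n := by linarith
  have hn2' : n < 2 := by linarith
  have hsq : (-7921 / 40000 : ℝ) + 89 / 200 * n ≤ (n / 2) ^ 2 := by nlinarith [sq_nonneg (n - 89 / 100)]
  have hsqU : ((-7921 / 40000 : ℝ) + 89 / 200 * n) * (5) ≤ (n / 2) ^ 2 * (5) :=
    mul_le_mul_of_nonneg_right hsq (by norm_num)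
  have hnpos : (0 : ℝ) < n := by linarith
  -- CAP at `U_c = 5`: vacuum chord of the kernel AF-Hartree–Fock half-filling cap (convexity in `n`, `e(0) = 0`)
  have hcap := objE_vacChord_cap (by norm_num : (0 : ℝ) ≤ 5) (afhfCap_n1_U5_at t' (by norm_num : (0 : ℝ) ≤ 5) le_rfl) hnpos (by linarith)
  rcases le_or_gt t' (-1 / 4) with hp0 | hp0
  · -- piece `[-7/20, -1/4]`, columns `-7/20`, `-1/4`
    have ra := fermiSeaTangentRow_tPrime_neg_seven_div_twenty_at_nine_div_ten (U := 0) le_rfl hn0 hn2'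
    have rb := fermiSeaTangentRow_tPrime_neg_one_div_four_at_ninetythree_div_hundred (U := 0) le_rfl hn0 hn2'
    have hfl := objE_floorChord_mul (s := t') (k := 10) hn0 hn2' (by norm_num : (-7 / 20 : ℝ) < -1 / 4) ra rb ht1 hp0 (by norm_num)
    exact doccN_lt_of_capUc_threshold (U₁ := 5) (Uc := 5) (by norm_num) (by norm_num) hU hn0 hn2' hcap hfl
      (by nlinarith only [mul_nonneg (sub_nonneg.2 hn1) (sub_nonneg.2 ht1), mul_nonneg (sub_nonneg.2 hn1) (sub_nonneg.2 hp0), mul_nonneg (sub_nonneg.2 hn2) (sub_nonneg.2 ht1), mul_nonneg (sub_nonneg.2 hn2) (sub_nonneg.2 hp0), hsqU])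
  · -- `t' > -1/4`
    have ra := fermiSeaTangentRow_tPrime_neg_one_div_four_at_ninetythree_div_hundred (U := 0) le_rfl hn0 hn2'
    have rb := fermiSeaTangentRow_tPrime_neg_seventeen_div_hundred_at_nine_div_ten (U := 0) le_rfl hn0 hn2'
    have hfl := objE_floorChord_mul (s := t') (k := 25 / 2) hn0 hn2' (by norm_num : (-1 / 4 : ℝ) < -17 / 100) ra rb hp0.le ht2 (by norm_num)
    exact doccN_lt_of_capUc_threshold (U₁ := 5) (Uc := 5) (by norm_num) (by norm_num) hU hn0 hn2' hcap hfl
      (by nlinarith only [mul_nonneg (sub_nonneg.2 hn1) (sub_nonneg.2 hp0.le), mul_nonneg (sub_nonneg.2 hn1) (sub_nonneg.2 ht2), mul_nonneg (sub_nonneg.2 hn2) (sub_nonneg.2 hp0.le), mul_nonneg (sub_nonneg.2 hn2) (sub_nonneg.2 ht2), hsqU])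

end Summit.Ventures.CertifiedManyBodySolver.Observables

end
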